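import Summits.CriticalPhenomena.PercolationContinuityZ3.Theorems.PercFiniteBoxLRORenormaliseFromLinearLROSpineDefs
import Summits.CriticalPhenomena.PercolationContinuityZ3.Theorems.PercFiniteBoxLRORenormaliseFromLinearLROStubDenseGlue

/-!
# `stub_spineGlue` of line `registered` (crux `PercFiniteBoxLRO.RenormaliseFromLinearLRO`,
# stmt-CriticalPhenomena-0857, reshape 3): an infinite coarse cluster of SPINE blocks carries an
# infinite open cluster meeting `Λ(K n)`

Registered stub `stub_spineGlue` of the lead's skeleton (reshape 3): the deterministic pull-back of the
planar coarse-graining `blockCfg (L·n) (spineBox K s m L)` of spine blocks (objects file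
`…SpineDefs.lean`), `n = (2s+1)m`, `m ≥ 1`, `L ≥ 1`.  If the cluster of `0` in the coarse configuration
of spine blocks is infinite, some vertex of `Λ(K n) = box 3 (K n)` has an infinite open cluster in `ω`.

Proof.
* One base point `X w` (local coordinates, `X w ∈ Λ(K n)` by `mem_of_joinedCount_pos`) is chosen for
  every window `w ∈ ℤ²` of the layer of spacing `n`, from the dense event when the window is dense.
* Inside a good spine block `a` (spacing `L·n`): its windows `L·a + j·eᵢ`, `0 ≤ j ≤ L`, are consecutive
  neighbours of the layer of spacing `n`, all dense (`mem_blockEvent_spineBox_iff`), so by the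
  pigeonhole gluing `dense_reachable_of_adj` of reshape 2, iterated along `j` (`spine_reachable_window`),
  the global base point of the centre window `L·a` is joined in `ω` to that of the end window
  `L·a + L·eᵢ = L·(a + eᵢ)`, which is the centre window of the spine block `a + eᵢ`
  (`spine_reachable_of_adj`).
* Induction along coarse open paths (`spine_reachable_of_coarse`): a coarse-open edge `{a, a + eᵢ}` has
  both spine blocks good (unfolding `blockCfg`), so every spine block `b` of the coarse cluster of `0` has
  `X (L·b) + blockCentre n (L·b)` joined to `X 0`.
* Finite-to-one (`stub_spineGlue`, copied from `stub_denseGlue`): `X (L·b) ∈ Λ(K n)` and the spacing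
  `L·n ≥ 1`, so these points are unbounded when the coarse cluster is infinite, whence the open cluster
  of `X 0 ∈ Λ(K n)` is infinite.

References: G. Grimmett, *Percolation*, 2nd ed. (1999), §7.4 pp.177–181 (static renormalisation,
Fig. 7.13); H. Duminil-Copin, V. Sidoravicius, V. Tassion, CPAM 69 (2016) §2.2.  The spine block and its
gluing are this line's device.  Pure theorem file.
-/

noncomputable section

namespace Summit.CriticalPhenomena.PercolationContinuityZ3.Theorems.RenormaliseFromLinearLRO

open Literature.Probability.Percolation Literature.Probability.LatticeModels
open MeasureTheory

/-! ## Window indices of spine blocks -/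

/-- The end window of the spine `a` in direction `eᵢ` is the centre window of the spine `a + eᵢ`:
`L·a + L·eᵢ = L·(a + eᵢ)`. -/
theorem spine_index_add_single (L : ℕ) (a : Site 2) (i : Fin 2) :
    (fun k => (L : ℤ) * a k) + Pi.single i (L : ℤ) =
      fun k => (L : ℤ) * (a + Pi.single i 1 : Site 2) k := by
  funext k
  simp only [Pi.add_apply, Pi.single_apply]
  split_ifs <;> ring

/-- The centre window of the spine `0` is the window `0`: `L·0 = 0`. -/
theorem spine_index_zero (L : ℕ) : (fun k => (L : ℤ) * (0 : Site 2) k) = 0 := by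
  funext k
  simp only [Pi.zero_apply, mul_zero]

/-- Consecutive windows of a spine: `(L·a + j·eᵢ) + eᵢ = L·a + (j+1)·eᵢ`. -/
theorem spine_index_succ (L : ℕ) (a : Site 2) (i : Fin 2) (j : ℕ) :
    (fun k => (L : ℤ) * a k) + Pi.single i (j : ℤ) + Pi.single i 1 =
      (fun k => (L : ℤ) * a k) + Pi.single i (((j + 1 : ℕ)) : ℤ) := by
  rw [add_assoc, ← Pi.single_add, Nat.cast_succ]

/-! ## Gluing inside a good spine block -/

/-- One gluing step (a repackaging of `dense_reachable_of_adj`): with one base point `X w` (local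
coordinates) chosen for every dense window `w` of the layer of spacing `n = (2s+1)m`, the global base
points of two dense neighbouring windows `b`, `b + eᵢ` are joined in `ω`. -/
theorem spine_step {K s m : ℕ} {ω : BondConfig (Site 3)} (X : Site 2 → Site 3)
    (hX : ∀ b : Site 2, ω ∈ blockEvent ((2 * s + 1) * m) (denseBox K s m) b →
      ∀ (j : Fin 2) (bb : Bool), largeCount s (halfGrid s m j bb)
          (BondConfig.relabel (sym2Equiv (Site.shift (-blockCentre ((2 * s + 1) * m) b))) ω) <
        2 * joinedCount s ↑(box 3 (K * ((2 * s + 1) * m))) (halfGrid s m j bb) (X b)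
          (BondConfig.relabel (sym2Equiv (Site.shift (-blockCentre ((2 * s + 1) * m) b))) ω))
    (b : Site 2) (i : Fin 2) (h1 : ω ∈ blockEvent ((2 * s + 1) * m) (denseBox K s m) b)
    (h2 : ω ∈ blockEvent ((2 * s + 1) * m) (denseBox K s m) (b + Pi.single i 1)) :
    (openGraph ω).Reachable (X b + blockCentre ((2 * s + 1) * m) b)
      (X (b + Pi.single i 1) + blockCentre ((2 * s + 1) * m) (b + Pi.single i 1)) :=
  dense_reachable_of_adj (K := K) b i (hX b h1 i true) (hX _ h2 i false)

/-- **Gluing along a spine.**  With one base point `X w` (local coordinates) chosen for every dense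
window `w` of the layer of spacing `n = (2s+1)m`, inside a good spine block `a` (spacing `L·n`) the
global base point of the centre window `L·a` is joined in `ω` to the global base point of the window
`L·a + j·eᵢ` for every `0 ≤ j ≤ L`: the windows `L·a + j'·eᵢ`, `|j'| ≤ L`, are all dense
(`mem_blockEvent_spineBox_iff`) and consecutive ones glue by pigeonhole (`spine_step`). -/
theorem spine_reachable_window {K s m L : ℕ} {ω : BondConfig (Site 3)} (X : Site 2 → Site 3)
    (hX : ∀ b : Site 2, ω ∈ blockEvent ((2 * s + 1) * m) (denseBox K s m) b →
      ∀ (j : Fin 2) (bb : Bool), largeCount s (halfGrid s m j bb)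
          (BondConfig.relabel (sym2Equiv (Site.shift (-blockCentre ((2 * s + 1) * m) b))) ω) <
        2 * joinedCount s ↑(box 3 (K * ((2 * s + 1) * m))) (halfGrid s m j bb) (X b)
          (BondConfig.relabel (sym2Equiv (Site.shift (-blockCentre ((2 * s + 1) * m) b))) ω))
    {a : Site 2} (ha : ω ∈ blockEvent (L * ((2 * s + 1) * m)) (spineBox K s m L) a) (i : Fin 2)
    {j : ℕ} (hj : j ≤ L) :
    (openGraph ω).Reachable
      (X (fun k => (L : ℤ) * a k) + blockCentre ((2 * s + 1) * m) (fun k => (L : ℤ) * a k))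
      (X ((fun k => (L : ℤ) * a k) + Pi.single i (j : ℤ)) +
        blockCentre ((2 * s + 1) * m) ((fun k => (L : ℤ) * a k) + Pi.single i (j : ℤ))) := by
  rw [mem_blockEvent_spineBox_iff] at ha
  induction j with
  | zero =>
    rw [Nat.cast_zero, Pi.single_zero, add_zero]
  | succ j ih =>
    have hjL : j ≤ L := Nat.le_of_succ_le hj
    -- the consecutive windows `L·a + j·eᵢ` and `L·a + (j+1)·eᵢ` are dense
    have h1 : ω ∈ blockEvent ((2 * s + 1) * m) (denseBox K s m)
        ((fun k => (L : ℤ) * a k) + Pi.single i (j : ℤ)) :=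
      ha i j (by rw [Nat.abs_cast]; exact_mod_cast hjL)
    have h2 : ω ∈ blockEvent ((2 * s + 1) * m) (denseBox K s m)
        ((fun k => (L : ℤ) * a k) + Pi.single i (j : ℤ) + Pi.single i 1) := by
      rw [spine_index_succ]
      exact ha i ((j + 1 : ℕ) : ℤ) (by rw [Nat.abs_cast]; exact_mod_cast hj)
    have key := spine_step (K := K) X hX _ i h1 h2
    rw [spine_index_succ] at key
    exact (ih hjL).trans key

/-- **Gluing of neighbouring spine blocks** `a`, `a + eᵢ`: if the spine block `a` is good, the global base
point of its centre window `L·a` is joined in `ω` to the global base point of the centre window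
`L·(a + eᵢ) = L·a + L·eᵢ` of the spine block `a + eᵢ` (the end window of the spine of `a`). -/
theorem spine_reachable_of_adj {K s m L : ℕ} {ω : BondConfig (Site 3)} (X : Site 2 → Site 3)
    (hX : ∀ b : Site 2, ω ∈ blockEvent ((2 * s + 1) * m) (denseBox K s m) b →
      ∀ (j : Fin 2) (bb : Bool), largeCount s (halfGrid s m j bb)
          (BondConfig.relabel (sym2Equiv (Site.shift (-blockCentre ((2 * s + 1) * m) b))) ω) <
        2 * joinedCount s ↑(box 3 (K * ((2 * s + 1) * m))) (halfGrid s m j bb) (X b)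
          (BondConfig.relabel (sym2Equiv (Site.shift (-blockCentre ((2 * s + 1) * m) b))) ω))
    {a : Site 2} (ha : ω ∈ blockEvent (L * ((2 * s + 1) * m)) (spineBox K s m L) a) (i : Fin 2) :
    (openGraph ω).Reachable
      (X (fun k => (L : ℤ) * a k) + blockCentre ((2 * s + 1) * m) (fun k => (L : ℤ) * a k))
      (X (fun k => (L : ℤ) * (a + Pi.single i 1 : Site 2) k) +
        blockCentre ((2 * s + 1) * m) (fun k => (L : ℤ) * (a + Pi.single i 1 : Site 2) k)) := by
  have h := spine_reachable_window X hX ha i le_rfl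
  rwa [spine_index_add_single] at h

/-! ## Along coarse open paths of spine blocks -/

/-- **Induction along coarse open paths of spine blocks.**  Every spine block `b` of the coarse open
cluster of `0` (spacing `L·n`) has the global base point `X (L·b) + blockCentre n (L·b)` of its centre
window joined to `X 0 + blockCentre n 0` in `ω`: each coarse-open edge is `{a, a + eᵢ}` with both spine
blocks good (unfolding `blockCfg`), glued by `spine_reachable_of_adj`. -/
theorem spine_reachable_of_coarse {K s m L : ℕ} {ω : BondConfig (Site 3)} (X : Site 2 → Site 3)
    (hX : ∀ b : Site 2, ω ∈ blockEvent ((2 * s + 1) * m) (denseBox K s m) b →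
      ∀ (j : Fin 2) (bb : Bool), largeCount s (halfGrid s m j bb)
          (BondConfig.relabel (sym2Equiv (Site.shift (-blockCentre ((2 * s + 1) * m) b))) ω) <
        2 * joinedCount s ↑(box 3 (K * ((2 * s + 1) * m))) (halfGrid s m j bb) (X b)
          (BondConfig.relabel (sym2Equiv (Site.shift (-blockCentre ((2 * s + 1) * m) b))) ω))
    {b : Site 2}
    (h : (openGraph (blockCfg (L * ((2 * s + 1) * m)) (spineBox K s m L) ω)).Reachable 0 b) :
    (openGraph ω).Reachable (X 0 + blockCentre ((2 * s + 1) * m) 0)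
      (X (fun k => (L : ℤ) * b k) + blockCentre ((2 * s + 1) * m) (fun k => (L : ℤ) * b k)) := by
  rw [SimpleGraph.reachable_iff_reflTransGen] at h
  induction h with
  | refl => rw [spine_index_zero]
  | @tail b₁ b₂ _ hadj ih =>
    obtain ⟨hmem, -⟩ := (openGraph_adj _ b₁ b₂).1 hadj
    simp only [blockCfg, Set.mem_setOf_eq] at hmem
    obtain ⟨a, i, he, hga, -⟩ := hmem
    have key := spine_reachable_of_adj (K := K) X hX hga i
    rw [Sym2.eq_iff] at he
    rcases he with ⟨rfl, rfl⟩ | ⟨rfl, rfl⟩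
    · exact ih.trans key
    · exact ih.trans key.symm

/-! ## The registered stub -/

/-- **Registered stub `stub_spineGlue` of crux stmt-CriticalPhenomena-0857 (line `registered`,
reshape 3)**, `m ≥ 1`, `L ≥ 1`: if the cluster of `0` in the coarse configuration of spine blocks
(spacing `L·n`, `n = (2s+1)m`) is infinite, some vertex of `Λ(K n)` has an infinite open cluster in
`ω` — consecutive windows of a spine glue by pigeonhole and the end window of a spine is the centre
window of the next spine (`spine_reachable_of_adj`), so the base points of the centre windows of the
spine blocks of the coarse cluster of `0`, all joined to the base point `X 0 ∈ Λ(K n)` of the window `0`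
and each inside its own window, form an unbounded set. -/
theorem stub_spineGlue :
    ∀ (K s m L : ℕ), 1 ≤ m → 1 ≤ L → ∀ (ω : BondConfig (Site 3)),
      blockCfg (L * ((2 * s + 1) * m)) (spineBox K s m L) ω ∈ percolatesAt (0 : Site 2) →
        ∃ x ∈ box 3 (K * ((2 * s + 1) * m)), ω ∈ percolatesAt x := by
  intro K s m L hm hL ω hperc
  set n : ℕ := (2 * s + 1) * m with hn
  have hn1 : 1 ≤ n := Nat.mul_pos (Nat.succ_pos _) hm
  set N : ℕ := K * n with hN
  -- one base point per dense window of the layer of spacing `n` (local coordinates), `0` otherwise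
  -- (adapted from `stub_denseGlue`, StubDenseGlue.lean)
  have hXex : ∀ b : Site 2, ∃ x : Site 3, x ∈ box 3 N ∧
      (ω ∈ blockEvent n (denseBox K s m) b → ∀ (j : Fin 2) (bb : Bool),
        largeCount s (halfGrid s m j bb)
            (BondConfig.relabel (sym2Equiv (Site.shift (-blockCentre n b))) ω) <
          2 * joinedCount s ↑(box 3 N) (halfGrid s m j bb) x
            (BondConfig.relabel (sym2Equiv (Site.shift (-blockCentre n b))) ω)) := by
    intro b
    by_cases hb : ω ∈ blockEvent n (denseBox K s m) b
    · have hb' : BondConfig.relabel (sym2Equiv (Site.shift (-blockCentre n b))) ω ∈ denseBox K s m := hb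
      obtain ⟨x, hx⟩ := hb'
      have h0 := hx 0 true
      have hpos : 0 < joinedCount s ↑(box 3 N) (halfGrid s m 0 true) x
          (BondConfig.relabel (sym2Equiv (Site.shift (-blockCentre n b))) ω) := by
        have h0' : largeCount s (halfGrid s m 0 true)
            (BondConfig.relabel (sym2Equiv (Site.shift (-blockCentre n b))) ω) <
          2 * joinedCount s ↑(box 3 N) (halfGrid s m 0 true) x
            (BondConfig.relabel (sym2Equiv (Site.shift (-blockCentre n b))) ω) := h0
        omega
      exact ⟨x, Finset.mem_coe.1 (mem_of_joinedCount_pos hpos), fun _ => hx⟩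
    · exact ⟨0, by simp, fun h => absurd h hb⟩
  choose X hXbox hX using hXex
  refine ⟨X 0, hXbox 0, ?_⟩
  -- finite-to-one: adapted from `stub_denseGlue` / `stub_coarseGlue`
  have hinf : (openCluster (blockCfg (L * n) (spineBox K s m L) ω) (0 : Site 2)).Infinite := hperc
  by_contra hcon
  have hcon' : ¬ (openCluster ω (X 0)).Infinite := hcon
  have hfin : (openCluster ω (X 0)).Finite := Set.not_infinite.1 hcon'
  obtain ⟨M, hM⟩ : ∃ M : ℕ, ∀ v ∈ openCluster ω (X 0), |v 0| ≤ M ∧ |v 1| ≤ M := by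
    obtain ⟨B, hB⟩ := (hfin.image fun v => max |v 0| |v 1|).bddAbove
    refine ⟨B.toNat, fun v hv => ?_⟩
    have h' : max |v 0| |v 1| ≤ (B.toNat : ℤ) :=
      (hB (Set.mem_image_of_mem _ hv)).trans (Int.self_le_toNat B)
    exact ⟨(le_max_left _ _).trans h', (le_max_right _ _).trans h'⟩
  obtain ⟨y, hy, hyF⟩ := hinf.exists_notMem_finset (box 2 (M + N))
  have hreach := spine_reachable_of_coarse (K := K) X hX hy
  rw [blockCentre_zero, add_zero] at hreach
  obtain ⟨h0, h1⟩ := hM _ hreach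
  set Y : Site 2 := fun k => (L : ℤ) * y k with hY
  have e0 : (X Y + blockCentre n Y) 0 = X Y 0 + n * (L * y 0) := by simp [blockCentre, hY]
  have e1 : (X Y + blockCentre n Y) 1 = X Y 1 + n * (L * y 1) := by simp [blockCentre, hY]
  rw [e0, abs_le] at h0
  rw [e1, abs_le] at h1
  have hXy := mem_box.1 (hXbox Y)
  obtain ⟨hx0, hx0'⟩ := hXy 0
  obtain ⟨hx1, hx1'⟩ := hXy 1
  have key : ∀ i, (y i).natAbs ≤ ((n : ℤ) * ((L : ℤ) * y i)).natAbs := fun i => by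
    rw [Int.natAbs_mul, Int.natAbs_natCast, Int.natAbs_mul, Int.natAbs_natCast]
    exact (Nat.le_mul_of_pos_left _ hL).trans (Nat.le_mul_of_pos_left _ hn1)
  have k0 := key 0
  have k1 := key 1
  simp only [mem_box, not_forall, not_and_or, not_le] at hyF
  obtain ⟨j, hj⟩ := hyF
  fin_cases j <;> simp at hj <;> omega

end Summit.CriticalPhenomena.PercolationContinuityZ3.Theorems.RenormaliseFromLinearLRO

end
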